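import Mathlib.NumberTheory.SumTwoSquares
import Mathlib.NumberTheory.Real.Irrational
import Mathlib.RingTheory.Ideal.GoingUp
import Mathlib.LinearAlgebra.FiniteDimensional.Lemmas
import Literature.NumberTheory.EllipticCurves.X1ElevenDescentValuation
import HarnessLib

/-!
# The valuation of `ℚ(i, √q)` above a prime `q ≡ 1 (mod 4)`: the automorphism fixing `ℚ(i)` is
# inertial (theorems only)

For a prime `q ≡ 1 (mod 4)` and the biquadratic field `J = ℚ(i, √q)` (`i² = -1`, `r² = q`; the
genus field of `ℚ(√-q)`), let `σ` be the automorphism with `σ i = i`, `σ r = -r` (the generator of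
`Gal(J/ℚ(i))`). Classically: `q = π π̄` splits in `ℤ[i]` (`q = s² + t²`), each `π ∣ q` is RAMIFIED in
`J = ℚ(i)(√q)` (`r² = q ∈ (π) ∖ (π)²`), so the prime `𝔔 ∣ π` of `J` is unique, `σ`-stable, of
residue degree `1` over `π`, and `σ` generates the inertia group `I(𝔔 ∣ π) = Gal(J/ℚ(i))`, i.e. acts
trivially on `𝓞_J/𝔔` (Neukirch, *Algebraic Number Theory*, Ch. I (1.4), (9.5)–(9.6); Marcus, *Number
Fields*, Ch. 3 Thm. 25, Ch. 4 Thm. 28; Cox, *Primes of the form x² + ny²*, §6.A for the genus field). This file PROVES it in the valuation currency of the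
tree (`Valuation J ℝ≥0`, as in `GoodReductionInertia` / `X1ElevenDescentValuation` and the
`bsd-goldfeld` cell's `X049GenusHalfTraceDatum.val_map / val_inertia / val_two / val_seven`):

* `val_map_eq_of_gaussSqrt_coords` / `val_sub_lt_one_of_gaussSqrt_coords` (§5): for ANY valuation
  `v : Valuation J ℝ≥0` of a field `J ∋ i, r` of characteristic `0` with `v q < 1` and any ring
  endomorphism `σ` with `σ i = i`, `σ r = -r`: `v (σ x) = v x` and `v x ≤ 1 → v (σ x - x) < 1` for
  every `x ∈ ℚ ⊕ ℚ i ⊕ ℚ r ⊕ ℚ i r`;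
* `exists_rat_coords_of_finrank_eq_four` (§6): such coordinates exist once `[J : ℚ] = 4`;
* `exists_inertial_valuation_gaussSqrt[_of_coords]` (§7): for `[J : ℚ] = 4` (resp. given
  coordinates) there is `w : Valuation J ℝ≥0` with `w ∘ σ = w`, `w x ≤ 1 → w (σ x - x) < 1`,
  `w 2 = 1`, `w 7 = 1` — the `𝔔`-adic valuation (`X1Eleven.adicValNNReal`) of a maximal ideal
  `𝔔 ∋ q` of `𝓞 J` (Mathlib `Ideal.exists_ideal_over_maximal_of_isIntegral`);
* `inertialValuation_gaussSqrt_schema` / `inertialValuation_gaussSqrt_of_mod_eight` (§8): the same as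
  a `∀ q`-schema over `J : Type`, `σ : J ≃ₐ[ℚ] J` — token for token the binder `hram` of the
  `bsd-goldfeld` cone `nonempty_genusHalfTraceDatum_of_shimuraReciprocity` and its `∀ q` consumers.

## Proof (elementary: no ramification indices, no computation of `𝓞_J`; all read off the value group)

1. (§2) With `q = s² + t²` (Mathlib `Nat.Prime.sq_add_sq`), exactly one of `π = s + t i`,
   `π̄ = s - t i` has `v < 1` (product `= q`; both small would give `q ∣ 2s, 2t`, `q² ∣ q`); choose
   signs so that `v π < 1 = v π̄`, whence `v π = v q`.
2. (§3) `ℤ → ℤ[i]/(π)` is onto: with `a t + b q = 1`, `u + w i = a (t u - s w) + π γ` for an explicit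
   `γ ∈ ℤ[i]`; so `v (u + w i) < 1` forces `u + w i = π (u' + w' i)`. Induction on the norm gives
   `v (ℤ[i] ∖ 0) ⊆ (v π)^ℕ` and `v (ℚ(i)ˣ) ⊆ (v π)^ℤ` — `q` is UNRAMIFIED in `ℚ(i)` at `v`.
3. (§4) `(v r)² = v q = v π ∉ (v π)^{2ℤ}`, so `v A ≠ v (B r)` for Gaussian rationals `A, B` not both
   zero — `v` is RAMIFIED in `J/ℚ(i)`.
4. (§5) For `x = A + B r`: `σ x = A - B r`, so `v (σ x) = max (v A) (v (B r)) = v x`; and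
   `σ x - x = -2 B r` with `v (B r) ≤ v x ≤ 1`, `v (B r) ≠ v 1`, so `v (σ x - x) < 1`.

## Design

Theorems only (no `def`, no named fact; D-0026). The core is stated for an arbitrary field of
characteristic `0` and `σ` in any `RingHomClass` (so `σ : J ≃ₐ[ℚ] J`, e.g. `τ.trans ρ`, applies
verbatim). Written as the residual input "(c)" of the genus-field half-trace construction for
`X₀(49)` over `ℚ(√-q)`, `q ≡ 5 (mod 8)` (`bsd-goldfeld`), but nothing here mentions elliptic
curves. NOT here: `𝓞_J`, ramification indices, the other primes of `J`.

## References

* [NeukirchANT1999] J. Neukirch, *Algebraic Number Theory*, Grundlehren 322, Springer (1999),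
  Ch. I (1.1), (1.4) (Gaussian primes: `p ≡ 1 (mod 4)` splits as `π π̄`), (8.2) (fundamental
  identity), (9.5)–(9.6) (inertia group `I_𝔓`, `#I_𝔓 = e`) — held copy read, PDF pp. 10–12, 50,
  61–62.
* [Marcus2018] D. A. Marcus, *Number Fields*, 2nd ed., Universitext, Springer (2018), Ch. 2
  Ex. 29 (the biquadratic field `ℚ[√m, √n] = {a + b√m + c√n + d√mn}`), Ch. 3 Thm. 25 (primes in
  quadratic fields: `p ∣ m ⇒ pR = (p, √m)²`), Ch. 4 Thm. 28 and Cor. 1 (decomposition and inertia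
  groups `E(Q|P) = {σ : σ α ≡ α (mod Q)}`, `#E = e`) — held copy read, PDF pp. 45, 63, 83–85.
* [Cox2013] D. A. Cox, *Primes of the form x² + ny²*, 2nd ed., Wiley (2013), §6.A (genus field).
-/

noncomputable section

open scoped NNReal
open NumberField

namespace Literature.NumberTheory.NumberFields

open Literature.NumberTheory.EllipticCurves (val_natCast_le_one val_intCast_le_one)
open Literature.NumberTheory.EllipticCurves.X1Eleven (val_intCast_lt_one_iff_dvd adicValNNReal
  adicValNNReal_natCast_lt_one_iff)

universe u

section Core

variable {J : Type u} [Field J] (v : Valuation J ℝ≥0)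

/-! ## §1 Values of integers, of `i`, of Gaussian integers -/

/-- `v x ^ 2 = 1 → v x = 1` in `ℝ≥0`. [folklore] -/
private theorem val_eq_one_of_sq_eq_one {x : J} (h : v x ^ 2 = 1) : v x = 1 := by
  rcases lt_trichotomy (v x) 1 with hlt | heq | hgt
  · exact absurd h (pow_lt_one₀ zero_le hlt two_ne_zero).ne
  · exact heq
  · exact absurd h (one_lt_pow₀ hgt two_ne_zero).ne'

/-- `v i = 1` when `i² = -1`. [folklore] -/
private theorem val_eq_one_of_sq_eq_neg_one {i : J} (hi : i ^ 2 = -1) : v i = 1 :=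
  val_eq_one_of_sq_eq_one v (by rw [← Valuation.map_pow, hi, Valuation.map_neg, Valuation.map_one])

/-- Gaussian integers `u + w i` are `v`-integral: `v (u + w i) ≤ 1`. [folklore] -/
private theorem val_gaussInt_le_one {i : J} (hi : i ^ 2 = -1) (u w : ℤ) :
    v ((u : J) + w * i) ≤ 1 :=
  (Valuation.map_add v _ _).trans (max_le (val_intCast_le_one v u)
    (by rw [Valuation.map_mul, val_eq_one_of_sq_eq_neg_one v hi, mul_one]
        exact val_intCast_le_one v w))

variable [CharZero J] {q : ℕ}

/-- `v n = 1` for an integer `n` prime to `q`, when `v q < 1` (Bézout). [folklore] -/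
private theorem val_intCast_eq_one_of_not_dvd (hq : q.Prime) (hvq : v (q : J) < 1) {n : ℤ}
    (hn : ¬ (q : ℤ) ∣ n) : v (n : J) = 1 :=
  le_antisymm (val_intCast_le_one v n)
    (not_lt.mp fun h => hn ((val_intCast_lt_one_iff_dvd v hq hvq n).mp h))

/-- `v 2 = 1` for `q` odd (here: `q % 4 = 1`). [folklore] -/
private theorem val_two_eq_one (hq : q.Prime) (hq4 : q % 4 = 1) (hvq : v (q : J) < 1) : v (2 : J) = 1 := by
  have h := val_intCast_eq_one_of_not_dvd v hq hvq (n := 2) (by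
    intro h
    have h1 := Int.le_of_dvd two_pos h
    have h2 := hq.two_le
    omega)
  exact_mod_cast h

/-- `v 7 = 1` for `q ≠ 7` (here: `q % 4 = 1`). [folklore] -/
private theorem val_seven_eq_one (hq : q.Prime) (hq4 : q % 4 = 1) (hvq : v (q : J) < 1) :
    v (7 : J) = 1 := by
  have h := val_intCast_eq_one_of_not_dvd v hq hvq (n := 7) (by
    intro h
    have h1 : q ∣ 7 := by exact_mod_cast h
    rcases (Nat.dvd_prime Nat.prime_seven).mp h1 with h2 | h2
    · exact hq.one_lt.ne' h2
    · omega)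
  exact_mod_cast h

/-- A prime is not the square of a rational number. [folklore] -/
private theorem rat_sq_ne_prime (hq : q.Prime) (u : ℚ) : u ^ 2 ≠ (q : ℚ) := by
  intro h
  refine hq.irrational_sqrt ⟨|u|, ?_⟩
  have h0 : (0 : ℝ) ≤ ((|u| : ℚ) : ℝ) := by exact_mod_cast abs_nonneg u
  have h' : (((|u| : ℚ) : ℝ)) ^ 2 = (q : ℝ) := by
    rw [Rat.cast_abs, sq_abs]; exact_mod_cast h
  rw [← Real.sqrt_sq h0, h']

/-- A prime is not the square of an integer. [folklore] -/
private theorem int_sq_ne_prime (hq : q.Prime) (s : ℤ) : s ^ 2 ≠ (q : ℤ) := fun h =>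
  rat_sq_ne_prime hq s (by exact_mod_cast h)

/-! ## §2 The Gaussian prime `π = s + t i` above `q` on the side of `v` -/

/-- **Fermat–Euler splitting of `q ≡ 1 (mod 4)` in `ℤ[i]`, read off `v`.** There are integers
`s, t` with `s² + t² = q`, `v (s + t i) < 1` and `v (s - t i) = 1` (the two Gaussian primes above
`q`: their product has value `v q < 1`; they are not both small, else `q ∣ 2s, 2t`).
[cite: NeukirchANT1999, Ch. I (1.1), (1.4)] [cite: Marcus2018, Ch. 3 Thm. 25] -/
theorem exists_gaussPrime (hq : q.Prime) (hq4 : q % 4 = 1) (hvq : v (q : J) < 1) {i : J}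
    (hi : i ^ 2 = -1) :
    ∃ s t : ℤ, s ^ 2 + t ^ 2 = q ∧ v ((s : J) + t * i) < 1 ∧ v ((s : J) - t * i) = 1 := by
  haveI := Fact.mk hq
  obtain ⟨a, b, hab⟩ := Nat.Prime.sq_add_sq (p := q) (by omega)
  have hvi := val_eq_one_of_sq_eq_neg_one v hi
  have hq' : Prime (q : ℤ) := Nat.prime_iff_prime_int.mp hq
  have hq2 : ¬ (q : ℤ) ∣ 2 := by
    intro h
    have h1 := Int.le_of_dvd two_pos h
    have h2 := hq.two_le
    omega
  have habZ : (a : ℤ) ^ 2 + (b : ℤ) ^ 2 = q := by exact_mod_cast hab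
  have habJ : ((a : J) + b * i) * ((a : J) - b * i) = (q : J) := by
    have e : ((a : J) + b * i) * ((a : J) - b * i) = (a : J) ^ 2 + (b : J) ^ 2 := by
      linear_combination (-(b : J) ^ 2) * hi
    rw [e]; exact_mod_cast congrArg (Nat.cast (R := J)) hab
  have hprod : v ((a : J) + b * i) * v ((a : J) - b * i) = v (q : J) := by
    rw [← Valuation.map_mul, habJ]
  -- not both conjugates are small
  have hnot : ¬ (v ((a : J) + b * i) < 1 ∧ v ((a : J) - b * i) < 1) := by
    rintro ⟨h1, h2⟩
    have ha : v ((2 * a : ℤ) : J) < 1 := by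
      have e : ((2 * a : ℤ) : J) = ((a : J) + b * i) + ((a : J) - b * i) := by push_cast; ring
      rw [e]; exact (Valuation.map_add v _ _).trans_lt (max_lt h1 h2)
    have hb : v ((2 * b : ℤ) : J) < 1 := by
      have e : ((2 * b : ℤ) : J) * i = ((a : J) + b * i) - ((a : J) - b * i) := by push_cast; ring
      have h3 : v (((2 * b : ℤ) : J) * i) < 1 := by
        rw [e]; exact (Valuation.map_sub v _ _).trans_lt (max_lt h1 h2)
      rwa [Valuation.map_mul, hvi, mul_one] at h3
    rw [val_intCast_lt_one_iff_dvd v hq hvq] at ha hb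
    obtain ⟨k, hk⟩ : (q : ℤ) ∣ a := ((hq'.dvd_or_dvd ha).resolve_left hq2)
    obtain ⟨l, hl⟩ : (q : ℤ) ∣ b := ((hq'.dvd_or_dvd hb).resolve_left hq2)
    have hab' := habZ
    rw [hk, hl] at hab'
    have h4 : (q : ℤ) * (q * (k ^ 2 + l ^ 2)) = (q : ℤ) * 1 := by linear_combination hab'
    have h5 := mul_left_cancel₀ (by exact_mod_cast hq.ne_zero) h4
    have h6 : (q : ℤ) = 1 := Int.eq_one_of_dvd_one (by positivity) ⟨_, h5.symm⟩
    exact hq.one_lt.ne' (by exact_mod_cast h6)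
  have hle : v ((a : J) - b * i) ≤ 1 := by
    have h := val_gaussInt_le_one v hi a (-b)
    push_cast at h
    rwa [neg_mul, ← sub_eq_add_neg] at h
  by_cases h1 : v ((a : J) + b * i) < 1
  · refine ⟨a, b, habZ, by exact_mod_cast h1, ?_⟩
    have h2 : ¬ v ((a : J) - b * i) < 1 := fun h2 => hnot ⟨h1, h2⟩
    push_cast
    exact le_antisymm hle (not_lt.mp h2)
  · have heq : v ((a : J) + b * i) = 1 :=
      le_antisymm (by exact_mod_cast val_gaussInt_le_one v hi a b) (not_lt.mp h1)
    rw [heq, one_mul] at hprod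
    refine ⟨a, -b, by linear_combination habZ, ?_, ?_⟩
    · push_cast
      rw [neg_mul, ← sub_eq_add_neg, hprod]; exact hvq
    · push_cast
      rw [neg_mul, sub_neg_eq_add]; exact heq

omit [CharZero J] in
/-- `v π = v q` for the Gaussian prime of `exists_gaussPrime`. [folklore] -/
private theorem val_gaussPrime_eq {i : J} (hi : i ^ 2 = -1) {s t : ℤ} (hst : s ^ 2 + t ^ 2 = q)
    (hπ1 : v ((s : J) - t * i) = 1) : v ((s : J) + t * i) = v (q : J) := by
  have e : ((s : J) + t * i) * ((s : J) - t * i) = (q : J) := by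
    have e1 : ((s : J) + t * i) * ((s : J) - t * i) = (s : J) ^ 2 + (t : J) ^ 2 := by
      linear_combination (-(t : J) ^ 2) * hi
    rw [e1]; exact_mod_cast congrArg (Int.cast (R := J)) hst
  rw [← e, Valuation.map_mul, hπ1, mul_one]

/-! ## §3 Division by `π` in `ℤ[i]` and the value group of `ℚ(i)` -/

/-- **Division step.** If `s² + t² = q`, `v (s + t i) < 1` and `v (u + w i) < 1` for integers
`u, w`, then `u + w i = (s + t i)(u' + w' i)` in `ℤ[i]`, i.e. `u = s u' - t w'`, `w = s w' + t u'`
for some integers `u', w'` (`ℤ → ℤ[i]/(π)` is onto: `u + w i ≡ a (t u - s w) (mod π)` where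
`a t + b q = 1`). [folklore] -/
private theorem exists_eq_gaussPrime_mul (hq : q.Prime) (hvq : v (q : J) < 1) {i : J} (hi : i ^ 2 = -1)
    {s t : ℤ} (hst : s ^ 2 + t ^ 2 = q) (hπ : v ((s : J) + t * i) < 1) {u w : ℤ}
    (huw : v ((u : J) + w * i) < 1) :
    ∃ u' w' : ℤ, u = s * u' - t * w' ∧ w = s * w' + t * u' := by
  -- `t` is prime to `q`
  have ht : ¬ (q : ℤ) ∣ t := by
    rintro ⟨k, rfl⟩
    rcases eq_or_ne k 0 with rfl | hk
    · exact int_sq_ne_prime hq s (by simpa using hst)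
    · have hk1 : (1 : ℤ) ≤ k ^ 2 := by
        have := Int.one_le_abs hk
        nlinarith [abs_nonneg k, sq_abs k]
      have hq2 : (2 : ℤ) ≤ q := by exact_mod_cast hq.two_le
      have hqq : (q : ℤ) ^ 2 ≤ (q : ℤ) ^ 2 * k ^ 2 := le_mul_of_one_le_right (sq_nonneg _) hk1
      nlinarith [sq_nonneg s]
  have hcop : IsCoprime (q : ℤ) t :=
    (Irreducible.coprime_iff_not_dvd (Nat.prime_iff_prime_int.mp hq).irreducible).mpr ht
  obtain ⟨b, a, hab⟩ := hcop
  -- the division identity `u + w i = m + π γ`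
  set m : ℤ := a * (t * u - s * w) with hm
  set g₁ : ℤ := a * w + b * (s * u + t * w) with hg₁
  set g₂ : ℤ := b * (s * w - t * u) with hg₂
  have hstJ : (s : J) ^ 2 + (t : J) ^ 2 = (q : J) := by exact_mod_cast congrArg (Int.cast (R := J)) hst
  have habJ : (b : J) * q + a * t = 1 := by exact_mod_cast congrArg (Int.cast (R := J)) hab
  have key : (m : J) = ((u : J) + w * i) - ((s : J) + t * i) * ((g₁ : J) + g₂ * i) := by
    simp only [hm, hg₁, hg₂]
    push_cast
    linear_combination (t : J) * (b * (s * w - t * u)) * hi + ((u : J) + w * i) * habJ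
      + ((b : J) * ((u : J) + w * i)) * hstJ
  have hvm : v (m : J) < 1 := by
    rw [key]
    refine (Valuation.map_sub v _ _).trans_lt (max_lt huw ?_)
    rw [Valuation.map_mul]
    calc v ((s : J) + t * i) * v ((g₁ : J) + g₂ * i) ≤ v ((s : J) + t * i) * 1 := by
          gcongr; exact val_gaussInt_le_one v hi g₁ g₂
      _ < 1 := by rw [mul_one]; exact hπ
  obtain ⟨m', hm'⟩ := (val_intCast_lt_one_iff_dvd v hq hvq m).mp hvm
  refine ⟨s * m' + g₁, g₂ - t * m', ?_, ?_⟩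
  · simp only [hg₁, hg₂]
    linear_combination (-(m' + b * u)) * hst + hm' - u * hab
  · simp only [hg₁, hg₂]
    linear_combination (-(b * w)) * hst - w * hab

/-- **`v` on `ℤ[i] ∖ 0` takes values in `(v π)^ℕ`** (induction on the norm `u² + w²`, dividing
by `π` while the value is `< 1`). [folklore] -/
private theorem exists_val_gaussInt_eq_pow (hq : q.Prime) (hvq : v (q : J) < 1) {i : J} (hi : i ^ 2 = -1)
    {s t : ℤ} (hst : s ^ 2 + t ^ 2 = q) (hπ : v ((s : J) + t * i) < 1) (n : ℕ) :
    ∀ u w : ℤ, u ^ 2 + w ^ 2 = n → (u ≠ 0 ∨ w ≠ 0) →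
      ∃ k : ℕ, v ((u : J) + w * i) = v ((s : J) + t * i) ^ k := by
  induction n using Nat.strong_induction_on with
  | _ n ih =>
  intro u w hn hne
  by_cases h1 : v ((u : J) + w * i) < 1
  · obtain ⟨u', w', hu, hw⟩ := exists_eq_gaussPrime_mul v hq hvq hi hst hπ h1
    have hne' : u' ≠ 0 ∨ w' ≠ 0 := by
      by_contra h
      push Not at h
      obtain ⟨h2, h3⟩ := h
      rw [h2, h3] at hu hw
      simp only [mul_zero, sub_zero, add_zero] at hu hw
      exact hne.elim (fun h => h hu) (fun h => h hw)
    have hmul : u ^ 2 + w ^ 2 = q * (u' ^ 2 + w' ^ 2) := by rw [hu, hw, ← hst]; ring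
    have hpos : 0 < u' ^ 2 + w' ^ 2 := by
      rcases hne' with h | h
      · have := Int.one_le_abs h; nlinarith [sq_abs u', sq_nonneg w']
      · have := Int.one_le_abs h; nlinarith [sq_abs w', sq_nonneg u']
    obtain ⟨n', hn'⟩ : ∃ n' : ℕ, (n' : ℤ) = u' ^ 2 + w' ^ 2 :=
      ⟨(u' ^ 2 + w' ^ 2).toNat, Int.toNat_of_nonneg hpos.le⟩
    have hlt : n' < n := by
      have h2 : (2 : ℤ) ≤ q := by exact_mod_cast hq.two_le
      have h3 : (n' : ℤ) < n := by rw [hn', ← hn, hmul]; nlinarith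
      exact_mod_cast h3
    obtain ⟨k, hk⟩ := ih n' hlt u' w' hn'.symm hne'
    refine ⟨k + 1, ?_⟩
    have e : (u : J) + w * i = ((s : J) + t * i) * ((u' : J) + w' * i) := by
      rw [hu, hw]; push_cast; linear_combination (-(t : J) * w') * hi
    rw [e, Valuation.map_mul, hk, pow_succ']
  · exact ⟨0, by rw [pow_zero]; exact le_antisymm (val_gaussInt_le_one v hi u w) (not_lt.mp h1)⟩

/-- **`v` on `ℤ[i] ∖ 0` takes values in `(v π)^ℕ`** (packaged without the norm). [folklore] -/
private theorem exists_val_gaussInt_eq_pow' (hq : q.Prime) (hvq : v (q : J) < 1) {i : J} (hi : i ^ 2 = -1)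
    {s t : ℤ} (hst : s ^ 2 + t ^ 2 = q) (hπ : v ((s : J) + t * i) < 1) (u w : ℤ)
    (hne : u ≠ 0 ∨ w ≠ 0) : ∃ k : ℕ, v ((u : J) + w * i) = v ((s : J) + t * i) ^ k :=
  exists_val_gaussInt_eq_pow v hq hvq hi hst hπ (u ^ 2 + w ^ 2).toNat u w
    (Int.toNat_of_nonneg (by positivity)).symm hne

/-- `(s + t i) ≠ 0` in `J` when `s² + t² = q`. [folklore] -/
private theorem gaussPrime_ne_zero (hq : q.Prime) {i : J} (hi : i ^ 2 = -1) {s t : ℤ}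
    (hst : s ^ 2 + t ^ 2 = q) : (s : J) + t * i ≠ 0 := by
  intro h
  have e : ((s : J) + t * i) * ((s : J) - t * i) = (q : J) := by
    have e1 : ((s : J) + t * i) * ((s : J) - t * i) = (s : J) ^ 2 + (t : J) ^ 2 := by
      linear_combination (-(t : J) ^ 2) * hi
    rw [e1]; exact_mod_cast congrArg (Int.cast (R := J)) hst
  rw [h, zero_mul] at e
  exact hq.ne_zero (by exact_mod_cast e.symm)

/-- **`v` on `ℚ(i) ∖ 0` takes values in `(v π)^ℤ`**: `q ≡ 1 (mod 4)` is unramified in `ℚ(i)`,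
`q = π π̄` with `π = s + t i` (read at a valuation `v` above `π`).
[cite: NeukirchANT1999, Ch. I (1.4)] [cite: Marcus2018, Ch. 3 Thm. 25] -/
theorem exists_val_gaussRat_eq_zpow (hq : q.Prime) (hvq : v (q : J) < 1) {i : J} (hi : i ^ 2 = -1)
    {s t : ℤ} (hst : s ^ 2 + t ^ 2 = q) (hπ : v ((s : J) + t * i) < 1) {a b : ℚ}
    (hab : (a : J) + b * i ≠ 0) :
    ∃ k : ℤ, v ((a : J) + b * i) = v ((s : J) + t * i) ^ k := by
  -- clear denominators: `(a + b i) D = U + W i`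
  have hD0 : ((a.den * b.den : ℕ) : J) ≠ 0 := by exact_mod_cast mul_ne_zero a.den_nz b.den_nz
  have ha : (a : J) * (a.den : J) = (a.num : J) := by
    have h := congrArg (fun x : ℚ => (x : J)) (Rat.mul_den_eq_num a)
    push_cast at h; exact h
  have hb : (b : J) * (b.den : J) = (b.num : J) := by
    have h := congrArg (fun x : ℚ => (x : J)) (Rat.mul_den_eq_num b)
    push_cast at h; exact h
  have hmul : ((a : J) + b * i) * ((a.den * b.den : ℕ) : J) =
      ((a.num * b.den : ℤ) : J) + ((b.num * a.den : ℤ) : J) * i := by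
    push_cast
    linear_combination (b.den : J) * ha + ((a.den : J) * i) * hb
  have hne : a.num * b.den ≠ 0 ∨ b.num * a.den ≠ 0 := by
    by_contra h
    push Not at h
    obtain ⟨h1, h2⟩ := h
    apply hab
    have h3 : ((a : J) + b * i) * ((a.den * b.den : ℕ) : J) = 0 := by
      rw [hmul, h1, h2]; push_cast; ring
    exact (mul_eq_zero.mp h3).resolve_right hD0
  obtain ⟨k₁, hk₁⟩ := exists_val_gaussInt_eq_pow' v hq hvq hi hst hπ _ _ hne
  obtain ⟨k₂, hk₂⟩ := exists_val_gaussInt_eq_pow' v hq hvq hi hst hπ ((a.den * b.den : ℕ) : ℤ) 0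
    (Or.inl (by exact_mod_cast mul_ne_zero a.den_nz b.den_nz))
  have hvD : v ((a.den * b.den : ℕ) : J) = v ((s : J) + t * i) ^ k₂ := by
    rw [← hk₂, Int.cast_natCast, Int.cast_zero, zero_mul, add_zero]
  have hvπ0 : v ((s : J) + t * i) ≠ 0 := (Valuation.ne_zero_iff v).mpr (gaussPrime_ne_zero hq hi hst)
  refine ⟨(k₁ : ℤ) - k₂, ?_⟩
  rw [zpow_sub₀ hvπ0, zpow_natCast, zpow_natCast, ← hk₁, ← hvD,
    eq_div_iff ((Valuation.ne_zero_iff v).mpr hD0), ← Valuation.map_mul, hmul]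

/-! ## §4 `v` is ramified in `J/ℚ(i)`: Gaussian-rational values never match `v (B r)` -/

/-- **Key lemma (`π` ramifies in `ℚ(i)(√q)`: `r² = q ∈ (π) ∖ (π²)`).** For `r² = q` and Gaussian
rationals `A = a + b i`, `B = c + d i` not both zero, `v A ≠ v (B r)`: `v A, v B ∈ (v π)^ℤ` while
`(v r)² = v q = v π`. [cite: Marcus2018, Ch. 3 Thm. 25] [cite: NeukirchANT1999, Ch. I (8.2)] -/
theorem val_gaussRat_ne_val_mul_sqrt (hq : q.Prime) (hq4 : q % 4 = 1) (hvq : v (q : J) < 1)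
    {i r : J} (hi : i ^ 2 = -1) (hr : r ^ 2 = (q : J)) {a b c d : ℚ}
    (h0 : (a : J) + b * i ≠ 0 ∨ (c : J) + d * i ≠ 0) :
    v ((a : J) + b * i) ≠ v (((c : J) + d * i) * r) := by
  obtain ⟨s, t, hst, hπ, hπ1⟩ := exists_gaussPrime v hq hq4 hvq hi
  have hvπq := val_gaussPrime_eq v hi hst hπ1
  have hr0 : r ≠ 0 := fun h => by
    rw [h, zero_pow two_ne_zero] at hr
    exact hq.ne_zero (by exact_mod_cast hr.symm)
  have hvr : v r ^ 2 = v ((s : J) + t * i) := by rw [← Valuation.map_pow, hr, hvπq]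
  by_cases hB : (c : J) + d * i = 0
  · have hA : (a : J) + b * i ≠ 0 := h0.resolve_right (fun h => h hB)
    rw [hB, zero_mul, Valuation.map_zero]
    exact (Valuation.ne_zero_iff v).mpr hA
  by_cases hA : (a : J) + b * i = 0
  · rw [hA, Valuation.map_zero]
    exact ((Valuation.ne_zero_iff v).mpr (mul_ne_zero hB hr0)).symm
  obtain ⟨k₁, hk₁⟩ := exists_val_gaussRat_eq_zpow v hq hvq hi hst hπ hA
  obtain ⟨k₂, hk₂⟩ := exists_val_gaussRat_eq_zpow v hq hvq hi hst hπ hB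
  intro h
  have hπ0 : 0 < v ((s : J) + t * i) :=
    pos_iff_ne_zero.mpr ((Valuation.ne_zero_iff v).mpr (gaussPrime_ne_zero hq hi hst))
  have h2 : v ((s : J) + t * i) ^ (2 * k₁) = v ((s : J) + t * i) ^ (2 * k₂ + 1) := by
    have h3 : v ((a : J) + b * i) ^ 2 = v (((c : J) + d * i) * r) ^ 2 := by rw [h]
    rw [Valuation.map_mul, mul_pow, hvr, hk₁, hk₂, ← zpow_natCast, ← zpow_natCast, ← zpow_mul,
      ← zpow_mul] at h3
    push_cast at h3
    rw [zpow_add₀ hπ0.ne', zpow_one, mul_comm 2 k₁, mul_comm 2 k₂]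
    exact h3
  rw [zpow_right_inj₀ hπ0 hπ.ne] at h2
  omega

/-! ## §5 `σ`-invariance and inertia for elements with coordinates in `ℚ ⊕ ℚ i ⊕ ℚ r ⊕ ℚ i r` -/

variable {F : Type*} [FunLike F J J] [RingHomClass F J J]

/-- **`v ∘ σ = v`** on `x = a + b i + c r + d (i r)` (`a, b, c, d ∈ ℚ`) for `σ i = i`, `σ r = -r`
(`σ ∈ Gal(J/ℚ(i))` lies in the decomposition group of the unique prime above `π`): `x = A + B r`,
`σ x = A - B r`, and `v A ≠ v (B r)`.
[cite: Marcus2018, Ch. 4 Thm. 28] [cite: NeukirchANT1999, Ch. I (9.6)] -/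
theorem val_map_eq_of_gaussSqrt_coords (hq : q.Prime) (hq4 : q % 4 = 1) (hvq : v (q : J) < 1)
    {i r : J} (hi : i ^ 2 = -1) (hr : r ^ 2 = (q : J)) (σ : F) (hσi : σ i = i) (hσr : σ r = -r)
    {x : J} {a b c d : ℚ} (hx : x = a + b * i + c * r + d * (i * r)) : v (σ x) = v x := by
  have hxAB : x = ((a : J) + b * i) + ((c : J) + d * i) * r := by rw [hx]; ring
  have hσx : σ x = ((a : J) + b * i) + -(((c : J) + d * i) * r) := by
    rw [hx]; simp only [map_add, map_mul, map_ratCast, hσi, hσr]; ring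
  by_cases h0 : (a : J) + b * i = 0 ∧ (c : J) + d * i = 0
  · rw [hσx, hxAB, h0.1, h0.2]; simp
  have h0' : (a : J) + b * i ≠ 0 ∨ (c : J) + d * i ≠ 0 := by tauto
  have hne := val_gaussRat_ne_val_mul_sqrt v hq hq4 hvq hi hr h0'
  rw [hσx, hxAB, Valuation.map_add_of_distinct_val v hne,
    Valuation.map_add_of_distinct_val v (by rwa [Valuation.map_neg]), Valuation.map_neg]

/-- **`σ` is inertial for `v`** (`σ ∈ Gal(J/ℚ(i)) = I(𝔔 ∣ π)`, the inertia group
`{σ : σ α ≡ α (mod 𝔔)}` of the totally ramified prime: `#I = e = 2`): `v x ≤ 1 → v (σ x - x) < 1` on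
`x = a + b i + c r + d (i r)` (`σ x - x = -2 B r`, `v (B r) ≤ v x ≤ 1` and `v (B r) ≠ v 1`).
[cite: Marcus2018, Ch. 4 Thm. 28 and Cor. 1] [cite: NeukirchANT1999, Ch. I (9.5)–(9.6)] -/
theorem val_sub_lt_one_of_gaussSqrt_coords (hq : q.Prime) (hq4 : q % 4 = 1) (hvq : v (q : J) < 1)
    {i r : J} (hi : i ^ 2 = -1) (hr : r ^ 2 = (q : J)) (σ : F) (hσi : σ i = i) (hσr : σ r = -r)
    {x : J} {a b c d : ℚ} (hx : x = a + b * i + c * r + d * (i * r)) (hvx : v x ≤ 1) :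
    v (σ x - x) < 1 := by
  have hxAB : x = ((a : J) + b * i) + ((c : J) + d * i) * r := by rw [hx]; ring
  have hσx : σ x - x = -(2 * (((c : J) + d * i) * r)) := by
    rw [hx]; simp only [map_add, map_mul, map_ratCast, hσi, hσr]; ring
  rw [hσx, Valuation.map_neg, Valuation.map_mul, val_two_eq_one v hq hq4 hvq, one_mul]
  by_cases hB : (c : J) + d * i = 0
  · rw [hB, zero_mul, Valuation.map_zero]; exact one_pos
  -- `v (B r) ≠ 1 = v (1 + 0 i)`
  have hne1 : v (((c : J) + d * i) * r) ≠ 1 := by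
    have h := val_gaussRat_ne_val_mul_sqrt v hq hq4 hvq hi hr (a := 1) (b := 0) (c := c) (d := d)
      (Or.inl (by norm_num))
    have e : ((1 : ℚ) : J) + ((0 : ℚ) : J) * i = 1 := by push_cast; ring
    rw [e, Valuation.map_one] at h
    exact fun h' => h h'.symm
  -- `v (B r) ≤ v x`
  have hle : v (((c : J) + d * i) * r) ≤ v x := by
    by_cases hA : (a : J) + b * i = 0
    · rw [hxAB, hA, zero_add]
    · have hne := val_gaussRat_ne_val_mul_sqrt v hq hq4 hvq hi hr (Or.inl hA) (c := c) (d := d)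
      rw [hxAB, Valuation.map_add_of_distinct_val v hne]
      exact le_max_right _ _
  exact lt_of_le_of_ne (hle.trans hvx) hne1

/-! ## §6 Coordinates from `[J : ℚ] = 4` -/

/-- `a + b i = 0` with `a, b ∈ ℚ` forces `a = b = 0` (`i² = -1 < 0`). [folklore] -/
private theorem rat_eq_zero_of_add_mul_eq_zero {i : J} (hi : i ^ 2 = -1) {a b : ℚ}
    (h : (a : J) + b * i = 0) : a = 0 ∧ b = 0 := by
  by_cases hb : b = 0
  · rw [hb] at h; simp at h; exact ⟨h, hb⟩
  · exfalso
    have hi' : i = -(a : J) / b := by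
      have hb' : (b : J) ≠ 0 := by exact_mod_cast hb
      field_simp
      linear_combination h
    have h2 : ((-(a / b)) ^ 2 : ℚ) = -1 := by
      have h3 : ((-(a : J) / b)) ^ 2 = -1 := by rw [← hi', hi]
      exact_mod_cast (by push_cast; linear_combination h3 : (((-(a / b)) ^ 2 : ℚ) : J) = ((-1 : ℚ) : J))
    nlinarith [sq_nonneg (-(a / b))]

/-- `r ∉ ℚ(i)`: `r ≠ a + b i` for `r² = q` prime. [folklore] -/
private theorem sqrt_ne_gaussRat (hq : q.Prime) {i r : J} (hi : i ^ 2 = -1) (hr : r ^ 2 = (q : J))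
    (a b : ℚ) : r ≠ (a : J) + b * i := by
  intro h
  -- `r² = (a² - b²) + 2ab i = q`
  have h2 : ((a ^ 2 - b ^ 2 - q : ℚ) : J) + ((2 * a * b : ℚ) : J) * i = 0 := by
    push_cast
    linear_combination (-(r + ((a : J) + b * i))) * h + hr - (b : J) ^ 2 * hi
  obtain ⟨h3, h4⟩ := rat_eq_zero_of_add_mul_eq_zero hi h2
  rcases mul_eq_zero.mp h4 with h5 | hb
  · rcases mul_eq_zero.mp h5 with h6 | ha
    · norm_num at h6
    · rw [ha] at h3
      have : (0 : ℚ) < q := by exact_mod_cast hq.pos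
      nlinarith [sq_nonneg b]
  · rw [hb] at h3
    exact rat_sq_ne_prime hq a (by linear_combination h3)

/-- **Coordinates (the biquadratic field `ℚ[√m, √n] = {a + b√m + c√n + d√mn}`, here
`m = -1`, `n = q`).** If `[J : ℚ] = 4`, `i² = -1` and `r² = q` (prime), then `1, i, r, i r` is a
`ℚ`-basis of `J`: every `x` is `a + b i + c r + d (i r)`. [cite: Marcus2018, Ch. 2 Ex. 29] -/
theorem exists_rat_coords_of_finrank_eq_four (hq : q.Prime) (hJ : Module.finrank ℚ J = 4)
    {i r : J} (hi : i ^ 2 = -1) (hr : r ^ 2 = (q : J)) (x : J) :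
    ∃ a b c d : ℚ, x = a + b * i + c * r + d * (i * r) := by
  set e : Fin 4 → J := ![1, i, r, i * r] with he
  have hli : LinearIndependent ℚ e := by
    rw [Fintype.linearIndependent_iff]
    intro g hg
    simp only [he, Fin.sum_univ_four, Matrix.cons_val_zero, Matrix.cons_val_one,
      Matrix.cons_val, Rat.smul_def] at hg
    -- hg : g 0 * 1 + g 1 * i + g 2 * r + g 3 * (i * r) = 0
    have hB : (g 2 : J) + (g 3 : J) * i = 0 := by
      by_contra hB
      have hn : (g 2 : J) ^ 2 + (g 3 : J) ^ 2 ≠ 0 := by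
        intro hn
        apply hB
        have hn' : (g 2) ^ 2 + (g 3) ^ 2 = 0 := by exact_mod_cast hn
        have h2 : g 2 = 0 := by nlinarith [sq_nonneg (g 2), sq_nonneg (g 3)]
        have h3 : g 3 = 0 := by nlinarith [sq_nonneg (g 2), sq_nonneg (g 3)]
        rw [h2, h3]; push_cast; ring
      have hmulr : r * ((g 2 : J) ^ 2 + (g 3 : J) ^ 2) =
          -((g 0 : J) * g 2 + g 1 * g 3) + ((g 0 : J) * g 3 - g 1 * g 2) * i := by
        linear_combination ((g 2 : J) - g 3 * i) * hg + ((g 1 : J) * g 3 + (g 3 : J) ^ 2 * r) * hi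
      apply sqrt_ne_gaussRat hq hi hr (-(g 0 * g 2 + g 1 * g 3) / (g 2 ^ 2 + g 3 ^ 2))
        ((g 0 * g 3 - g 1 * g 2) / (g 2 ^ 2 + g 3 ^ 2))
      push_cast
      calc r = r * ((g 2 : J) ^ 2 + (g 3 : J) ^ 2) / ((g 2 : J) ^ 2 + (g 3 : J) ^ 2) :=
            (mul_div_cancel_right₀ r hn).symm
        _ = _ := by rw [hmulr]; ring
    obtain ⟨h2, h3⟩ := rat_eq_zero_of_add_mul_eq_zero hi hB
    have hA : (g 0 : J) + (g 1 : J) * i = 0 := by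
      rw [h2, h3] at hg; push_cast at hg; linear_combination hg
    obtain ⟨h0, h1⟩ := rat_eq_zero_of_add_mul_eq_zero hi hA
    intro j
    fin_cases j <;> assumption
  have hsp := hli.span_eq_top_of_card_eq_finrank (by rw [hJ]; simp)
  have hx : x ∈ Submodule.span ℚ (Set.range e) := by rw [hsp]; exact Submodule.mem_top
  rw [Submodule.mem_span_range_iff_exists_fun] at hx
  obtain ⟨g, hg⟩ := hx
  refine ⟨g 0, g 1, g 2, g 3, ?_⟩
  rw [← hg]
  simp only [he, Fin.sum_univ_four, Matrix.cons_val_zero, Matrix.cons_val_one, Matrix.cons_val,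
    Rat.smul_def]
  ring

end Core

/-! ## §7 The number-field packaging: an inertial valuation of `ℚ(i, √q)` above `q` -/

section NumberField

variable {J : Type u} [Field J]

/-- A maximal ideal of `𝓞 J` above the rational prime `q`. [folklore] -/
private theorem exists_maximal_natCast_mem [NumberField J] (q : ℕ) (hq : q.Prime) :
    ∃ Q : Ideal (𝓞 J), Q.IsMaximal ∧ (q : 𝓞 J) ∈ Q := by
  haveI hP : (Ideal.span {(q : ℤ)}).IsMaximal :=
    PrincipalIdealRing.isMaximal_of_irreducible (Nat.prime_iff_prime_int.mp hq).irreducible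
  obtain ⟨Q, hQ, hQP⟩ := Ideal.exists_ideal_over_maximal_of_isIntegral (S := 𝓞 J)
    (Ideal.span {(q : ℤ)}) (by
      rw [(RingHom.injective_iff_ker_eq_bot _).mp (algebraMap ℤ (𝓞 J)).injective_int]
      exact bot_le)
  refine ⟨Q, hQ, ?_⟩
  have h : (q : ℤ) ∈ Q.comap (algebraMap ℤ (𝓞 J)) := hQP ▸ Ideal.mem_span_singleton_self _
  simpa using h

/-- A valuation of the number field `J` into `ℝ≥0` with `v q < 1` (the `𝔔`-adic valuation of a
maximal ideal `𝔔 ∋ q` of `𝓞 J`, tree `X1Eleven.adicValNNReal`). [folklore] -/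
private theorem exists_valuation_natCast_lt_one [NumberField J] (q : ℕ) (hq : q.Prime) :
    ∃ v : Valuation J ℝ≥0, v (q : J) < 1 := by
  obtain ⟨Q, hQ, hqQ⟩ := exists_maximal_natCast_mem (J := J) q hq
  haveI := hQ
  exact ⟨adicValNNReal Q, (adicValNNReal_natCast_lt_one_iff Q q).mpr hqQ⟩

variable [CharZero J] {F : Type*} [FunLike F J J] [RingHomClass F J J]

/-- **An inertial valuation of `J = ℚ(i, √q)` above `q ≡ 1 (mod 4)`, coordinate form.** If every
element of the field `J` (characteristic `0`) has coordinates in `ℚ ⊕ ℚ i ⊕ ℚ r ⊕ ℚ i r`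
(`i² = -1`, `r² = q`, `q ≡ 1 (mod 4)` prime) and `σ` is a ring endomorphism with `σ i = i`,
`σ r = -r`, there is a valuation `w : J → ℝ≥0` with `w (σ x) = w x`, `w x ≤ 1 → w (σ x - x) < 1`,
`w 2 = 1`, `w 7 = 1` (the `𝔔`-adic valuation of a prime `𝔔` of `J` above `q`, where
`σ ∈ I(𝔔 ∣ q)`). [cite: Marcus2018, Ch. 4 Thm. 28 and Cor. 1] [cite: NeukirchANT1999, Ch. I (9.6)] -/
theorem exists_inertial_valuation_gaussSqrt_of_coords {q : ℕ} (hq : q.Prime) (hq4 : q % 4 = 1)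
    {i r : J} (hi : i ^ 2 = -1) (hr : r ^ 2 = (q : J))
    (hcoords : ∀ x : J, ∃ a b c d : ℚ, x = a + b * i + c * r + d * (i * r)) (σ : F)
    (hσi : σ i = i) (hσr : σ r = -r) :
    ∃ w : Valuation J ℝ≥0, (∀ x, w (σ x) = w x) ∧ (∀ x, w x ≤ 1 → w (σ x - x) < 1) ∧
      w 2 = 1 ∧ w 7 = 1 := by
  classical
  -- `J` is a number field: `1, i, r, i r` span it over `ℚ`
  haveI : FiniteDimensional ℚ J := by
    refine Module.finite_def.mpr ⟨{1, i, r, i * r}, le_antisymm le_top fun x _ => ?_⟩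
    obtain ⟨a, b, c, d, hx⟩ := hcoords x
    have hS : ∀ y ∈ ({1, i, r, i * r} : Finset J),
        y ∈ Submodule.span ℚ (↑({1, i, r, i * r} : Finset J)) :=
      fun y hy => Submodule.subset_span (Finset.mem_coe.mpr hy)
    rw [hx, show (a : J) + b * i + c * r + d * (i * r) = a • (1 : J) + b • i + c • r + d • (i * r) by
      simp only [Rat.smul_def, mul_one]]
    exact add_mem (add_mem (add_mem (Submodule.smul_mem _ _ (hS 1 (by simp)))
      (Submodule.smul_mem _ _ (hS i (by simp)))) (Submodule.smul_mem _ _ (hS r (by simp))))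
      (Submodule.smul_mem _ _ (hS (i * r) (by simp)))
  haveI : NumberField J := NumberField.mk
  obtain ⟨v, hvq⟩ := exists_valuation_natCast_lt_one (J := J) q hq
  refine ⟨v, fun x => ?_, fun x hx => ?_, val_two_eq_one v hq hq4 hvq, val_seven_eq_one v hq hq4 hvq⟩
  · obtain ⟨a, b, c, d, hx⟩ := hcoords x
    exact val_map_eq_of_gaussSqrt_coords v hq hq4 hvq hi hr σ hσi hσr hx
  · obtain ⟨a, b, c, d, hx'⟩ := hcoords x
    exact val_sub_lt_one_of_gaussSqrt_coords v hq hq4 hvq hi hr σ hσi hσr hx' hx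

/-- **An inertial valuation of `J = ℚ(i, √q)` above `q ≡ 1 (mod 4)`.** For a field `J` of
characteristic `0` with `[J : ℚ] = 4`, `i² = -1`, `r² = q` (`q ≡ 1 (mod 4)` prime) and a ring
endomorphism `σ` with `σ i = i`, `σ r = -r`, there is a valuation `w : J → ℝ≥0` with
`w (σ x) = w x`, `w x ≤ 1 → w (σ x - x) < 1`, `w 2 = 1` and `w 7 = 1` (the valuation at any prime
of `J` above `q`: `σ` generates the inertia group of the ramified extension `J/ℚ(i)` there).
[cite: Marcus2018, Ch. 4 Thm. 28 and Cor. 1] [cite: NeukirchANT1999, Ch. I (9.6)] -/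
theorem exists_inertial_valuation_gaussSqrt {q : ℕ} (hq : q.Prime) (hq4 : q % 4 = 1)
    (hJ : Module.finrank ℚ J = 4) {i r : J} (hi : i ^ 2 = -1) (hr : r ^ 2 = (q : J)) (σ : F)
    (hσi : σ i = i) (hσr : σ r = -r) :
    ∃ w : Valuation J ℝ≥0, (∀ x, w (σ x) = w x) ∧ (∀ x, w x ≤ 1 → w (σ x - x) < 1) ∧
      w 2 = 1 ∧ w 7 = 1 :=
  exists_inertial_valuation_gaussSqrt_of_coords hq hq4 hi hr
    (exists_rat_coords_of_finrank_eq_four hq hJ hi hr) σ hσi hσr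

end NumberField

/-! ## §8 The `∀ q`-schema in the shape consumed by the `bsd-goldfeld` half-trace cone -/

/-- **The inertial valuation of `ℚ(i, √q)` above `q ≡ 1 (mod 4)`, as a `∀ q`-schema** — TOKEN FOR
TOKEN the residual input `hram` ("(c)") of the genus-field half-trace datum for `X₀(49)` over
`ℚ(√-q)` (`Summits/…/GoldfeldK12AdditiveTwoHalfTraceOfShimuraReciprocityDatum.lean`): for every prime
`q ≡ 1 (mod 4)`, every field `J` of characteristic `0` with `[J : ℚ] = 4`, every `σ : J ≃ₐ[ℚ] J` and
`i, r ∈ J` with `i² = -1`, `r² = q`, `σ i = i`, `σ r = -r`, there is `w : Valuation J ℝ≥0` with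
`w ∘ σ = w`, `w x ≤ 1 → w (σ x - x) < 1`, `w 2 = 1`, `w 7 = 1`. Consumers discharge the binder by
this name (the per-`q` form is `inertialValuation_gaussSqrt_schema q hq hq4`).
[cite: Marcus2018, Ch. 4 Thm. 28 and Cor. 1] [cite: NeukirchANT1999, Ch. I (9.6)] -/
theorem inertialValuation_gaussSqrt_schema :
    ∀ (q : ℕ), q.Prime → q % 4 = 1 → ∀ (J : Type) [Field J] [CharZero J], Module.finrank ℚ J = 4 →
      ∀ (σ : J ≃ₐ[ℚ] J) (i r : J), i ^ 2 = -1 → r ^ 2 = (q : J) → σ i = i → σ r = -r →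
      ∃ w : Valuation J ℝ≥0, (∀ x, w (σ x) = w x) ∧ (∀ x, w x ≤ 1 → w (σ x - x) < 1) ∧ w 2 = 1 ∧ w 7 = 1 :=
  fun _ hq hq4 _ _ _ hJ σ _ _ hi hr hσi hσr ↦
    exists_inertial_valuation_gaussSqrt hq hq4 hJ hi hr σ hσi hσr

/-- The per-`q` form of `inertialValuation_gaussSqrt_schema` for `q ≡ 5 (mod 8)` (the shape of the
binder `hram` of `nonempty_genusHalfTraceDatum_of_shimuraReciprocity`).
[cite: Marcus2018, Ch. 4 Thm. 28 and Cor. 1] [cite: NeukirchANT1999, Ch. I (9.6)] -/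
theorem inertialValuation_gaussSqrt_of_mod_eight {q : ℕ} (hq : q.Prime) (hq8 : q % 8 = 5) :
    ∀ (J : Type) [Field J] [CharZero J], Module.finrank ℚ J = 4 →
      ∀ (σ : J ≃ₐ[ℚ] J) (i r : J), i ^ 2 = -1 → r ^ 2 = (q : J) → σ i = i → σ r = -r →
      ∃ w : Valuation J ℝ≥0, (∀ x, w (σ x) = w x) ∧ (∀ x, w x ≤ 1 → w (σ x - x) < 1) ∧ w 2 = 1 ∧ w 7 = 1 :=
  inertialValuation_gaussSqrt_schema q hq (by omega)

end Literature.NumberTheory.NumberFields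

end
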